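import Summits.BirchSwinnertonDyer.BirchSwinnertonDyer.Theorems.TameQuarticManinParityOptimalTwistNeronLatticeOfSplit
import Literature.NumberTheory.EllipticCurves.QuadraticTwist
import Literature.NumberTheory.EllipticCurves.RealLatticePeriod
import Literature.NumberTheory.EllipticCurves.IrreducibleModPQuadraticTwistProofs
import HarnessLib

/-!
# Route `TameQuarticManinParity`, LINE 25c (bsd-idea-3 g8), glue GA25 `TprimeIrrOptimalTwistIsTwistOfOptimalOfRigidity`
# (stmt-BirchSwinnertonDyer-22888) — PROVED BY NAME: S25 ∧ R25 ∧ I25 ⟹ α («twist of optimal is optimal» on the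
# irreducible (t′) pairs)

Cell `pub/bsd-wall`, D-0145 line `route-BirchSwinnertonDyer-TeichmullerTwistDescent`, seat `bsd-line-ttd-p1` g10.
The PROOF is planner bsd-idea-3 g8's (`ideas/l25/GA25_byname.lean` / `Sketch25c.lean`), re-checked against the tree and
wrapped in the Theorems conventions (provers are the only writers under `Theorems/`, D-0016). BSD is NOT proved by this;
Manin's conjecture is not proved by this; R25 (`ThreeKernelSandwichRigidity`, 22886), I25
(`VariableChangeOfRationalHomothety`, 22887) are hypotheses of the glue; S25 is landed
(`tprimeTwistLatticeSandwich_proof`); α (22822) follows once R25 and I25 land.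

## Proof (planner's)

`G := g(χ)`, `G² = −3`; `T := W ⊗ (−3)` is elliptic with Néron-type pair `LT := D.L.mulLeft G⁻¹`
(`g₂(LT) = G⁴ c₄(W)/12 = c₄(T)/12`, `quadraticTwist_c₄`; likewise `g₃`); `T[3]` irreducible from `W[3]`
(`hasIrreducibleModPGaloisRep_quadraticTwist_iff`); with `q := c_W/c_A`, exactness of both data, `smul_periodLattice_le`
and S25(1) give `qΛ_A ⊆ LT`, S25(2) gives `(3/q)·LT ⊆ Λ_A`; R25 gives `qΛ_A = LT` or `(q/3)Λ_A = LT`, and I25 gives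
`∃ v, v • T = A`. Design: theorems only; no definition, no named fact, no `sorry`; axioms `propext`, `Classical.choice`,
`Quot.sound`.
-/

set_option autoImplicit false
-- D-0017: single-problem summit, so `Summit.BirchSwinnertonDyer.BirchSwinnertonDyer.…` repeats a namespace BY DESIGN.
set_option linter.dupNamespace false

noncomputable section

namespace Summit.BirchSwinnertonDyer.BirchSwinnertonDyer.Theorems.TameQuarticManinParity

open Literature.NumberTheory.EllipticCurves.ModularForms WeierstrassCurve
  Summit.BirchSwinnertonDyer.BirchSwinnertonDyer.Theses.TameQuarticManinParity

/-- **Glue GA25 `TprimeIrrOptimalTwistIsTwistOfOptimalOfRigidity`** (stmt-BirchSwinnertonDyer-22888), by name: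
S25 ∧ R25 ∧ I25 ⟹ α. Planner bsd-idea-3 g8's proof (Sketch25c), re-checked. [cite: Stevens1989, Lemmas (5.2), (5.4)] -/
theorem tprimeIrrOptimalTwistIsTwistOfOptimalOfRigidity_proof : TprimeIrrOptimalTwistIsTwistOfOptimalOfRigidity := by
  unfold TprimeIrrOptimalTwistIsTwistOfOptimalOfRigidity
  intro hS hR hI W _ _ _ hcm hadd ht hirr h3 D hex hmin h9 χ hχ hprim A _ _ D' hf hex' hmin'
  set G : ℂ := gaussSum χ (ZMod.stdAddChar (N := 3)) with hG
  obtain ⟨hS1, hS2⟩ := hS W hadd D h9 χ hχ hprim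
  have hG2 : G ^ 2 = -3 := gaussSum_sq_eq_neg_three χ hχ hprim
  have hG0 : G ≠ 0 := by
    intro h; rw [h] at hG2; norm_num at hG2
  have hGi0 : G⁻¹ ≠ 0 := inv_ne_zero hG0
  have hc : D.c ≠ 0 := D.maninConstant_ne_zero_holds
  have hc' : D'.c ≠ 0 := D'.maninConstant_ne_zero_holds
  have hcℂ : (D.c : ℂ) ≠ 0 := by exact_mod_cast hc
  have hc'ℂ : (D'.c : ℂ) ≠ 0 := by exact_mod_cast hc'
  -- the twisted model `T = W ⊗ (−3)` and its Néron-type pair `G⁻¹ · Λ(W)`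
  have hd : (-3 : ℚ) ≠ 0 := by norm_num
  haveI : (W.quadraticTwist (-3)).IsElliptic := isElliptic_quadraticTwist W hd
  set LT : PeriodPair := D.L.mulLeft G⁻¹ hGi0 with hLT
  have hmemT : ∀ z : ℂ, z ∈ LT.lattice ↔ G * z ∈ D.L.lattice := fun z ↦ by
    rw [hLT, PeriodPair.mem_mulLeft_lattice, inv_inv]
  have hNT : IsNeronLatticeOf ((W.quadraticTwist (-3)).baseChange ℂ) LT := by
    obtain ⟨h₂, h₃⟩ := D.isNeronLattice
    have hG4 : G ^ 4 = 9 := by rw [show (4 : ℕ) = 2 * 2 from rfl, pow_mul, hG2]; norm_num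
    have hG6 : G ^ 6 = -27 := by rw [show (6 : ℕ) = 2 * 3 from rfl, pow_mul, hG2]; norm_num
    constructor
    · rw [hLT, PeriodPair.g₂_mulLeft, h₂, inv_pow, inv_inv, hG4]
      simp only [WeierstrassCurve.baseChange, WeierstrassCurve.map_c₄, WeierstrassCurve.quadraticTwist_c₄,
        map_mul, map_pow, map_neg, map_ofNat]
      ring
    · rw [hLT, PeriodPair.g₃_mulLeft, h₃, inv_pow, inv_inv, hG6]
      simp only [WeierstrassCurve.baseChange, WeierstrassCurve.map_c₆, WeierstrassCurve.quadraticTwist_c₆,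
        map_mul, map_pow, map_neg, map_ofNat]
      ring
  -- irreducibility of `T[3]` from that of `W[3]`
  have hirrT : (W.quadraticTwist (-3)).HasIrreducibleModPGaloisRep 3 :=
    (W.hasIrreducibleModPGaloisRep_quadraticTwist_iff hd 3).mpr hirr
  -- the sandwich `3Λ_T ⊆ qΛ_A ⊆ Λ_T`, `q = c/c'`
  set q : ℚ := (D.c : ℚ) / D'.c with hq
  have hq0 : q ≠ 0 := by
    rw [hq]; exact div_ne_zero (by exact_mod_cast hc) (by exact_mod_cast hc')
  have hqA : ∀ z ∈ D'.L.lattice, (q : ℂ) * z ∈ LT.lattice := by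
    intro z hz
    obtain ⟨w, hw, rfl⟩ := hex' z hz
    rw [hf] at hw
    have h1 : (D.c : ℂ) * (G * w) ∈ D.L.lattice := D.smul_periodLattice_le _ (hS1 w hw)
    rw [hmemT]
    convert h1 using 1
    rw [hq]; push_cast; field_simp
  have h3q : ∀ z ∈ LT.lattice, ((3 / q : ℚ) : ℂ) * z ∈ D'.L.lattice := by
    intro z hz
    have hz' : G * z ∈ D.L.lattice := (hmemT z).mp hz
    obtain ⟨w, hw, hGz⟩ := hex _ hz'
    obtain ⟨w', hw', h3w⟩ := hS2 w hw
    have hw'' : w' ∈ periodLattice D'.f := by rw [hf]; exact hw'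
    have h1 : (D'.c : ℂ) * w' ∈ D'.L.lattice := D'.smul_periodLattice_le _ hw''
    have hz_eq : z = (D.c : ℂ) * w / G := by
      rw [eq_div_iff hG0, mul_comm z G]; exact hGz
    have e : ((3 / q : ℚ) : ℂ) * z = (D'.c : ℂ) * (3 * w) / G := by
      rw [hz_eq, hq]; push_cast; field_simp
    rw [e, h3w, show (D'.c : ℂ) * (G * w') / G = (D'.c : ℂ) * w' by field_simp]
    exact h1
  -- rigidity: `qΛ_A = Λ_T` or `qΛ_A = 3Λ_T`; either way a rational homothety, hence a change of variables
  rcases hR (W.quadraticTwist (-3)) A LT D'.L hNT D'.isNeronLattice hirrT q hq0 hqA h3q with h | h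
  · exact hI (W.quadraticTwist (-3)) A LT D'.L hNT D'.isNeronLattice q hq0 h
  · exact hI (W.quadraticTwist (-3)) A LT D'.L hNT D'.isNeronLattice (q / 3)
      (div_ne_zero hq0 (by norm_num)) h


end Summit.BirchSwinnertonDyer.BirchSwinnertonDyer.Theorems.TameQuarticManinParity

end
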